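import Literature.Probability.Percolation.CornerPercolation
import Literature.Probability.Percolation.RSW
import Literature.Probability.LatticeModels.ProdBernoulliIndependence
import HarnessLib

/-!
# Stub `stub_smallBoxes` (crux stmt-CriticalPhenomena-6470 `SegmentRSW`, line `registered`):
# a `t`-uniform lower bound for `M_t(LR([0, 2n] × [0, n]))` at every fixed `n`

Finite-size input of the birth skeleton of
`Summit.CriticalPhenomena.CardyFormulaZ2.Theses.ModulusResponse.SegmentRSW`: the Bollobás–Riordan
engine delivers its uniform box-crossing constant for the corner models
`M_t = cornerPercolation t` only from some scale `n₀` on, and the finitely many scales `n < n₀` are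
absorbed here by finite energy, uniformly in `t ∈ [0, 1]`.

Proof. The bottom row of `[0, 2n] × [0, n]` consists of the `2n` east edges
`{(i, 0), (i + 1, 0)}`, `i < 2n` (`bottomRowEdges (2 n)` of `RSW.lean`); the east edge of `v` is
open in `cornerConfig S` iff the coin `(v, 0) ∈ S` (`east_mem_cornerConfig_iff`), and that coin is
FAIR for every `t` (`cornerParam_apply_zero`). Hence, with `F` the set of the `2n` bottom-row coins,
the cylinder `{S | F ⊆ S}` has `prodBernoulli (cornerParam t)`-probability `(1/2)^{#F}`
(`prodBernoulli_real_subset`) and is contained in `cornerConfig ⁻¹' LR(2n, n)`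
(`mem_lrCrossing_of_bottomRowEdges_subset`); `cornerPercolation_real_apply` and monotonicity finish.
-/

noncomputable section

namespace Summit.CriticalPhenomena.CardyFormulaZ2.Cruxes.SegmentRSW.Birth

open MeasureTheory ProbabilityTheory
open Literature.Probability.Percolation Literature.Probability.LatticeModels

/-- **Stub 3 (FINITE SIZE).** For each fixed `n ≥ 1` the hard-way crossing probability
`M_t(LR([0, 2n] × [0, n]))` of the corner model is bounded below by a positive constant independent
of `t ∈ [0, 1]`: the `2n` east edges of the bottom row are open iff their `2n` fair coins
`((i, 0), 0)`, `i < 2n`, all show `1`, an event of probability `(1/2)^{2n}` for every `t`, and then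
the bottom row is an open left-right crossing. [folklore] -/
theorem stub_smallBoxes :
    ∀ n : ℕ, 1 ≤ n → ∃ c : ℝ, 0 < c ∧ ∀ t : unitInterval,
      c ≤ (cornerPercolation t).real (lrCrossing (2 * n) n) := by
  intro n _
  -- the `2n` fair coins driving the east edges of the bottom row
  set F : Finset (Site 2 × Fin 2) :=
    (Finset.range (2 * n)).image fun i : ℕ => (pt i 0, (0 : Fin 2))
  refine ⟨(1 / 2 : ℝ) ^ F.card, by positivity, fun t => ?_⟩
  -- the coins of `F` are fair, whatever `t`
  have hfair : ∀ i ∈ F, ((cornerParam t i : unitInterval) : ℝ) = 1 / 2 := by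
    intro i hi
    obtain ⟨k, -, rfl⟩ := Finset.mem_image.1 hi
    rw [cornerParam_apply_zero, coe_half]
  -- if all coins of `F` show `1`, the bottom row is open, hence `LR(2n, n)` occurs
  have hrow : {S : Set (Site 2 × Fin 2) | (↑F : Set (Site 2 × Fin 2)) ⊆ S} ⊆
      cornerConfig ⁻¹' lrCrossing (2 * n) n := by
    intro S hS
    refine mem_lrCrossing_of_bottomRowEdges_subset fun e he => ?_
    obtain ⟨k, hk, rfl⟩ := Finset.mem_image.1 (Finset.mem_coe.1 he)
    rw [pt_succ_eq, ← vec10_eq_single, east_mem_cornerConfig_iff]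
    exact hS (Finset.mem_coe.2 (Finset.mem_image_of_mem _ hk))
  calc (1 / 2 : ℝ) ^ F.card = ∏ i ∈ F, ((cornerParam t i : unitInterval) : ℝ) := by
        rw [Finset.prod_congr rfl hfair, Finset.prod_const]
    _ = (prodBernoulli (cornerParam t)).real {S | (↑F : Set (Site 2 × Fin 2)) ⊆ S} :=
        (prodBernoulli_real_subset _ F).symm
    _ ≤ (prodBernoulli (cornerParam t)).real (cornerConfig ⁻¹' lrCrossing (2 * n) n) :=
        measureReal_mono hrow
    _ = (cornerPercolation t).real (lrCrossing (2 * n) n) :=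
        (cornerPercolation_real_apply t (measurableSet_lrCrossing _ _)).symm

end Summit.CriticalPhenomena.CardyFormulaZ2.Cruxes.SegmentRSW.Birth

end
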